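import Summits.HodgeConjecture.HodgeConjecture.Theses.TropicalWeilObstruction
import Summits.HodgeConjecture.HodgeConjecture.Theorems.TropicalWeilObstructionTropicalHodgeBoundCertificate
import Summits.HodgeConjecture.HodgeConjecture.Theorems.TropicalWeilObstructionTropicalHodgeBoundCertificateClasses
import Summits.HodgeConjecture.HodgeConjecture.Theorems.TropicalWeilObstructionTropicalHodgeBoundCycleClassRational
import Summits.HodgeConjecture.HodgeConjecture.Theorems.TropicalWeilObstructionTropicalHodgeBoundEigenwave
import Summits.HodgeConjecture.HodgeConjecture.Theorems.TropicalWeilObstructionTropicalHodgeBoundWeilPairingWeilClasses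
import HarnessLib

/-!
# Crux `TropicalHodgeBound` (route `TropicalWeilObstruction`), line `birth`: registered stub 4
# `stub_rationalHodgeCoordinates` — and the crux

Registered skeleton `Cruxes/TropicalHodgeBound/Lines/birth.lean` (crux item stmt-HodgeConjecture-18480),
stub `stub_rationalHodgeCoordinates : RationalHodgeCoordinates` (rendered, as in the sibling stub files,
by file-local `notation3` with the skeleton's bodies verbatim): for a positive definite `J`-commuting
Weil-generic period `Q` every tropical `(4,4)`-cycle class in `X_Q = ℝ⁸/Qℤ⁸` is a RATIONAL combination
of `θ₄(Q)`, `Re w(Q)`, `Im w(Q)` (Mikhalkin–Zharkov Thm. 5.4 / Zharkov §2: the Hodge classes form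
exactly this `3`-space, and tropical cycle classes are rational Hodge classes).

Proof (all ingredients in the sibling `…TropicalHodgeBound*` files of this seat):
(R) integrality — `cyc Z S S' = 576⁻¹ Σ_I det Q[S,I] · y(I,S')` with an alternating INTEGER table `y`
(`…CycleClassRational`, discrete Stokes); (H) the eigenwave identity (`…Eigenwave`); (G) genericity —
one integer linear equation per monomial (`…Genericity`); (C) the kernel-checked rank certificate
(`…Certificate`): every such `y` is `(y₀ + y₁₄) θ̃ - y₁₄ Re w̃ - y₄ Im w̃` on all word pairs
(`…CertificateClasses`); finally Cauchy–Binet (`sum_det_submatrix_mul_det_submatrix`) turns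
`Σ_I det Q[S,I] θ̃(I,S')`, `Σ_I det Q[S,I] w̃(I,S')` into `24 θ₄(Q)`, `24 w(Q)`, so
`cyc Z = (y₀ + y₁₄)/24 · θ₄ - y₁₄/24 · Re w - y₄/24 · Im w`. With
`tropicalHodgeBound_of_rationalHodgeCoordinates` (stubs 1–3, seat b02) this closes the crux
(`tropicalHodgeBound_proof`). No named fact, no sorry.

References: [MikhalkinZharkov2014Eigenwave] G. Mikhalkin, I. Zharkov, LN UMI 15 (2014), Prop. 4.3,
Thm. 5.4; [Zharkov2020TropicalWeil] I. Zharkov, arXiv:2002.02347, §2.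
-/

set_option linter.dupNamespace false

noncomputable section

open scoped BigOperators
open Matrix
open Literature.AlgebraicGeometry.Tropical

namespace Summit.HodgeConjecture.HodgeConjecture.Theorems.TropicalHodgeBound

/-! ## §0 Display-only notation (the skeleton's local definitions, verbatim bodies) -/

/-- The skeleton's `thetaClass n Q`. -/
local notation3 (prettyPrint := false) "θ⟦" n "⟧" Q:max =>
  (fun S S' : Fin n → Fin (2 * n) => Matrix.det (Matrix.submatrix Q S S'))

/-- The skeleton's `omegaFrame n` (`Ω`, the frame `ω_b = e_b - i e_{b+n}`). -/
local notation3 (prettyPrint := false) "Ω⟦" n "⟧" =>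
  (Matrix.of fun (a : Fin (2 * n)) (b : Fin n) =>
    (if (a : ℕ) = (b : ℕ) then (1 : ℂ) else 0) - (if (a : ℕ) = (b : ℕ) + n then Complex.I else 0))

/-- The skeleton's `weilClassC n Q` (`w(Q) = (⋀ⁿQ ⊗ 1)(Ω ⊗ Ω)`). -/
local notation3 (prettyPrint := false) "wC⟦" n "⟧" Q:max =>
  (fun S S' : Fin n → Fin (2 * n) =>
    Matrix.det (Matrix.submatrix (Matrix.map Q ((↑) : ℝ → ℂ) * Ω⟦n⟧) S id) *
      Matrix.det (Matrix.submatrix (Ω⟦n⟧) S' id))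

/-- The skeleton's `weilClassRe n Q` (`w₁ = Re w`). -/
local notation3 (prettyPrint := false) "wRe⟦" n "⟧" Q:max =>
  (fun S S' : Fin n → Fin (2 * n) => Complex.re ((wC⟦n⟧ Q) S S'))

/-- The skeleton's `weilClassIm n Q` (`w₂ = Im w`). -/
local notation3 (prettyPrint := false) "wIm⟦" n "⟧" Q:max =>
  (fun S S' : Fin n → Fin (2 * n) => Complex.im ((wC⟦n⟧ Q) S S'))

/-- The skeleton's `RationalHodgeCoordinates` (stub 4 statement). -/
local notation3 (prettyPrint := false) "RationalHodgeCoordinates" =>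
  (∀ Q : Matrix (Fin (2 * 4)) (Fin (2 * 4)) ℝ, Matrix.PosDef Q → Q * weilJ 4 = weilJ 4 * Q →
    IsWeilGeneric 4 Q → ∀ Z : TropicalTorusCycle (2 * 4) 4 Q, ∃ q : Fin 3 → ℚ,
      TropicalTorusCycle.cyc Z = ((q 0 : ℚ) : ℝ) • θ⟦4⟧ Q + ((q 1 : ℚ) : ℝ) • wRe⟦4⟧ Q +
        ((q 2 : ℚ) : ℝ) • wIm⟦4⟧ Q)

/-! ## §1 Cauchy–Binet for the two classes -/

/-- `θ̃` as a real determinant: `θ̃(I,J) = det 1[I,J]`. [folklore] -/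
theorem thetaZ_cast (I J : Fin 4 → Fin (2 * 4)) :
    ((Chk.thetaZ I J : ℤ) : ℝ) = ((1 : Matrix (Fin (2 * 4)) (Fin (2 * 4)) ℝ).submatrix I J).det := by
  unfold Chk.thetaZ
  rw [Chk.det4R_eq_det]
  have h := RingHom.map_det (Int.castRingHom ℝ) (Matrix.of fun a b => if I a = J b then (1 : ℤ) else 0)
  simp only [eq_intCast] at h
  rw [h]
  congr 1
  ext a b
  simp [Matrix.one_apply]

/-- `Σ_I det Q[S,I] · θ̃(I,S') = 4! · det Q[S,S']`. [folklore] -/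
theorem sum_det_mul_thetaZ (Q : Matrix (Fin (2 * 4)) (Fin (2 * 4)) ℝ) (S S' : Fin 4 → Fin (2 * 4)) :
    ∑ I : Fin 4 → Fin (2 * 4), (Q.submatrix S I).det * ((Chk.thetaZ I S' : ℤ) : ℝ) =
      24 * (Q.submatrix S S').det := by
  simp_rw [thetaZ_cast]
  have h := sum_det_submatrix_mul_det_submatrix (Q.submatrix S id)
    ((1 : Matrix (Fin (2 * 4)) (Fin (2 * 4)) ℝ).submatrix id S')
  simp only [Matrix.submatrix_submatrix, Function.comp_id, Function.id_comp] at h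
  rw [h, ← Matrix.submatrix_mul _ _ _ _ _ Function.bijective_id, Matrix.mul_one]
  norm_num [Nat.factorial]

/-- The `Ω`-minor over `ℂ`: `toComplex (det Ω[I,·]) = det Ω⟦4⟧[I,·]`. [cite: Zharkov2020TropicalWeil, §2] -/
theorem omegaMinorF_toComplex (I : Fin 4 → Fin (2 * 4)) :
    GaussianInt.toComplex (Chk.omegaMinorF I) = ((Ω⟦4⟧).submatrix I id).det := by
  unfold Chk.omegaMinorF
  rw [Chk.det4R_eq_det, RingHom.map_det]
  congr 1
  ext a b
  simp only [RingHom.mapMatrix_apply, Matrix.map_apply, Matrix.of_apply, Matrix.submatrix_apply, id,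
    Chk.omegaN]
  by_cases h1 : ((I a : ℕ)) = (b : ℕ)
  · have h2 : ¬ ((I a : ℕ)) = (b : ℕ) + 4 := by omega
    simp [h1]
  · by_cases h2 : ((I a : ℕ)) = (b : ℕ) + 4
    · simp [h2, GaussianInt.toComplex_def]
    · simp [h1, h2]

/-- `Σ_I det Q[S,I] · w̃(I,S') = 4! · w(Q)(S,S')` over `ℂ`. [cite: Zharkov2020TropicalWeil, §2] -/
theorem sum_det_mul_wG (Q : Matrix (Fin (2 * 4)) (Fin (2 * 4)) ℝ) (S S' : Fin 4 → Fin (2 * 4)) :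
    ∑ I : Fin 4 → Fin (2 * 4), ((Q.submatrix S I).det : ℂ) * GaussianInt.toComplex (Chk.wG I S') =
      24 * ((wC⟦4⟧ Q) S S') := by
  unfold Chk.wG
  simp_rw [map_mul, omegaMinorF_toComplex, ofReal_det]
  have h := sum_det_submatrix_mul_det_submatrix ((Q.map ((↑) : ℝ → ℂ)).submatrix S id) (Ω⟦4⟧)
  simp only [Matrix.submatrix_submatrix, Function.comp_id, Function.id_comp] at h
  have e : ∀ I : Fin 4 → Fin (2 * 4), ((Q.submatrix S I).map ((↑) : ℝ → ℂ)) =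
      (Q.map ((↑) : ℝ → ℂ)).submatrix S I := fun I => rfl
  simp_rw [e]
  calc ∑ I : Fin 4 → Fin (2 * 4), ((Q.map ((↑) : ℝ → ℂ)).submatrix S I).det *
        ((((Ω⟦4⟧).submatrix I id).det) * ((Ω⟦4⟧).submatrix S' id).det)
      = (∑ I : Fin 4 → Fin (2 * 4), ((Q.map ((↑) : ℝ → ℂ)).submatrix S I).det *
          ((Ω⟦4⟧).submatrix I id).det) * ((Ω⟦4⟧).submatrix S' id).det := by
        rw [Finset.sum_mul]; refine Finset.sum_congr rfl fun I _ => ?_; ring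
    _ = 24 * ((wC⟦4⟧ Q) S S') := by
        have hsub : (Q.map ((↑) : ℝ → ℂ)).submatrix S id * Ω⟦4⟧ =
            ((Q.map ((↑) : ℝ → ℂ)) * Ω⟦4⟧).submatrix S id := Matrix.ext fun _ _ => rfl
        have h24 : ((Nat.factorial 4 : ℕ) : ℂ) = 24 := by norm_num [Nat.factorial]
        rw [h, hsub, h24]
        beta_reduce
        ring

/-! ## §2 The registered stub 4 -/

/-- **Stub 4 (registered): rational Hodge coordinates of tropical cycle classes.** For `Q ≻ 0`,
`QJ = JQ`, `Q` Weil-generic, every tropical `(4,4)`-cycle class is a rational combination of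
`θ₄(Q), Re w(Q), Im w(Q)`. [cite: MikhalkinZharkov2014Eigenwave, Prop. 4.3, Thm. 5.4]
[cite: Zharkov2020TropicalWeil, §2] -/
theorem stub_rationalHodgeCoordinates : RationalHodgeCoordinates := by
  intro Q hQ hJ hgen Z
  -- basic facts about `Q`
  have hS : ∀ α β, Q α β = Q β α := fun α β => by
    simpa using (hQ.isHermitian.apply α β).symm
  have hdet : IsUnit Q.det := hQ.det_pos.ne'.isUnit
  -- the integer table and its symmetries
  let y : (Fin 4 → Fin (2 * 4)) → (Fin 4 → Fin (2 * 4)) → ℤ := fun I J => intCoord Z I J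
  have hyI : ∀ (c d : Fin 4 → Fin (2 * 4)) (τ : Equiv.Perm (Fin 4)),
      y (c ∘ τ) d = ((Equiv.Perm.sign τ : ℤˣ) : ℤ) * y c d := fun c d τ => intCoord_comp_perm_left Z c d τ
  have hyJ : ∀ (c d : Fin 4 → Fin (2 * 4)) (τ : Equiv.Perm (Fin 4)),
      y c (d ∘ τ) = ((Equiv.Perm.sign τ : ℤˣ) : ℤ) * y c d := fun c d τ => intCoord_comp_perm_right Z c d τ
  -- (H) + (R): the eigenwave identity for `y`
  have heig : ∀ (K' : Fin 5 → Fin (2 * 4)) (J' : Fin 3 → Fin (2 * 4)),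
      ∑ m : Fin 5, (-1 : ℝ) ^ (m : ℕ) * ∑ I : Fin 4 → Fin (2 * 4),
        (Q.submatrix (fun a => K' (m.succAbove a)) I).det * (y I (Fin.cons (K' m) J') : ℝ) = 0 := by
    intro K' J'
    have h := cyc_eigenwave Z K' J'
    simp_rw [cyc_eq_sum_det_mul_intCoord hdet Z] at h
    have e : ∑ m : Fin 5, (-1 : ℝ) ^ (m : ℕ) * ∑ I : Fin 4 → Fin (2 * 4),
        (Q.submatrix (fun a => K' (m.succAbove a)) I).det * (y I (Fin.cons (K' m) J') : ℝ) =
        576 * ∑ m : Fin 5, (-1 : ℝ) ^ (m : ℕ) * ((1 / 576 : ℝ) * ∑ I : Fin 4 → Fin (2 * 4),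
          (Q.submatrix (fun a => K' (m.succAbove a)) I).det * (intCoord Z I (Fin.cons (K' m) J') : ℝ)) := by
      rw [Finset.mul_sum]
      refine Finset.sum_congr rfl fun m _ => ?_
      ring
    rw [e, h, mul_zero]
  -- (G): the coefficient equations; (C): the certificate
  have heq := fun K' J' m₀ c₀ => coeffEquation_eq_zero hS hJ hgen y hyI K' J' (heig K' J') m₀ c₀
  have hrel : ∀ u < 4900, Chk.yvOf y u = Chk.relRHS (Chk.yvOf y) u :=
    fun u hu => Chk.rel_all y hyI hyJ heq u hu
  have hcls := Chk.y_eq_classes_of_rel y hyI hyJ hrel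
  -- the coefficients
  set A : ℤ := Chk.yvOf y 0 + Chk.yvOf y 14 with hA
  set B : ℤ := Chk.yvOf y 14 with hB
  set C : ℤ := Chk.yvOf y 4 with hC
  refine ⟨![(A : ℚ) / 24, -(B : ℚ) / 24, -(C : ℚ) / 24], ?_⟩
  funext S S'
  rw [cyc_eq_sum_det_mul_intCoord hdet Z S S']
  simp only [Pi.add_apply, Pi.smul_apply, smul_eq_mul, Matrix.cons_val_zero, Matrix.cons_val_one]
  have h2 : (![(A : ℚ) / 24, -(B : ℚ) / 24, -(C : ℚ) / 24] : Fin 3 → ℚ) 2 = -(C : ℚ) / 24 := rfl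
  rw [h2]
  -- substitute the classes for `y`
  have hy : ∀ I, (intCoord Z I S' : ℝ) = (A : ℝ) * ((Chk.thetaZ I S' : ℤ) : ℝ) -
      (B : ℝ) * (((Chk.wG I S').re : ℤ) : ℝ) - (C : ℝ) * (((Chk.wG I S').im : ℤ) : ℝ) := by
    intro I
    have := hcls I S'
    simp only [y] at this
    rw [this]; push_cast; ring
  simp_rw [hy]
  -- the real and imaginary parts of the complex Cauchy–Binet identity
  have hw := sum_det_mul_wG Q S S'
  have hre : ∑ I : Fin 4 → Fin (2 * 4), (Q.submatrix S I).det * (((Chk.wG I S').re : ℤ) : ℝ) =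
      24 * ((wC⟦4⟧ Q) S S').re := by
    have := congrArg Complex.re hw
    rw [Complex.re_sum] at this
    simp only [Complex.re_ofReal_mul, ← GaussianInt.intCast_re] at this
    rw [this]
    beta_reduce
    simp [Complex.mul_re]
  have him : ∑ I : Fin 4 → Fin (2 * 4), (Q.submatrix S I).det * (((Chk.wG I S').im : ℤ) : ℝ) =
      24 * ((wC⟦4⟧ Q) S S').im := by
    have := congrArg Complex.im hw
    rw [Complex.im_sum] at this
    simp only [Complex.im_ofReal_mul, ← GaussianInt.intCast_im] at this
    rw [this]
    beta_reduce
    simp [Complex.mul_im]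
  have hθ := sum_det_mul_thetaZ Q S S'
  -- split the sum
  have hsplit : ∑ I : Fin 4 → Fin (2 * 4), (Q.submatrix S I).det *
      ((A : ℝ) * ((Chk.thetaZ I S' : ℤ) : ℝ) - (B : ℝ) * (((Chk.wG I S').re : ℤ) : ℝ) -
        (C : ℝ) * (((Chk.wG I S').im : ℤ) : ℝ)) =
      (A : ℝ) * ∑ I : Fin 4 → Fin (2 * 4), (Q.submatrix S I).det * ((Chk.thetaZ I S' : ℤ) : ℝ) -
      (B : ℝ) * ∑ I : Fin 4 → Fin (2 * 4), (Q.submatrix S I).det * (((Chk.wG I S').re : ℤ) : ℝ) -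
      (C : ℝ) * ∑ I : Fin 4 → Fin (2 * 4), (Q.submatrix S I).det * (((Chk.wG I S').im : ℤ) : ℝ) := by
    rw [Finset.mul_sum, Finset.mul_sum, Finset.mul_sum, ← Finset.sum_sub_distrib, ← Finset.sum_sub_distrib]
    refine Finset.sum_congr rfl fun I _ => ?_
    ring
  rw [hsplit, hθ, hre, him]
  push_cast
  ring

/-! ## §3 The crux -/

/-- **The crux `TropicalHodgeBound`** (route `TropicalWeilObstruction`, K3): from stub 4 (this file)
and the composition `tropicalHodgeBound_of_rationalHodgeCoordinates` (stubs 1–3). For a positive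
definite `J`-commuting Weil-generic period, any three tropical `(4,4)`-cycles with `W(c_j) = 0` have
`ℚ`-linearly dependent classes. [cite: Zharkov2020TropicalWeil, §2]
[cite: MikhalkinZharkov2014Eigenwave, Thm. 5.4] -/
theorem tropicalHodgeBound_proof :
    Summit.HodgeConjecture.HodgeConjecture.Theses.TropicalWeilObstruction.TropicalHodgeBound :=
  tropicalHodgeBound_of_rationalHodgeCoordinates stub_rationalHodgeCoordinates

end Summit.HodgeConjecture.HodgeConjecture.Theorems.TropicalHodgeBound

end
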